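import Summits.KontsevichZagierPeriods.Zeta5Search.TwoTaleOmega.OmegaRegionR
import Summits.KontsevichZagierPeriods.Zeta5Search.TwoTaleOmega.StepBL
import Summits.KontsevichZagierPeriods.Zeta5Search.TwoTaleOmega.CertAtomsB

/-!
# (bmiss)@Ω — the recurrence in direction `b`, SECOND TALE (cell `pub-zeta5`, cert-1 gen 4)

HONEST FRAMING: systematic search; recurrence certificates; no irrationality claim unless certified. Pure finite algebra
over `ℚ`; no named fact, no `sorry`.

Blueprint `families/tele/RECURRENCE.md` §13.10–13.12, direction `δ = b`, side `R` (Zudilin's second tale, lattice variable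
`u = 2t`). INPUT: cert-2's kernel identity `Certificates.TwoTaleTelescope.telescope_b_R` (`Cert_R = (2t+a−1)(2t+a)(t+a−b)
(t+e+f−1)(t+g−1)·x/((2t+a−b+g−1)(2t+a−b+g−2)(2t+a−b+g−3))`, `x = (g−b−1)(g+b−a−1)`). OUTPUT (`recR_b`): for
`p, p+δ, p+2δ, p+3δ ∈ Ω`, `Σ_{k<4} c^b_k(p)·E¹_{nodeR(p+kδ)}[vR(p+kδ)] = 0` and the same for `E⁰` (truncation `0`), i.e. the
second-tale halves of `U1`, `U0`. STEPS as in `StepBL`: Γ-ratios and `t`-shift (`OmegaRegionR.vR_ratio_addB`, `vR_shift`),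
function identity by `telescope_assembly`, the telescoped function as closed-form data
`GfBR = ofFrac (2·[e,e+f−1) ∪ 2·[a,g−1)) (C(x·κ·2^{g−b−2})·block(a−1,g−b+a−3)·eblock(a−b,f))` (constant polynomial part),
data identity by Lemma U, legitimacy at the COMMON NODE `M* = −a` (simple zeros of `G` at `u = −a, −a+1`, not poles), node
moves inside the second-tale window (`altE_vR_move`), and `FormalBarnesStep.altE•_step2`.
-/

noncomputable section

open Finset Polynomial
open Literature.NumberTheory.Irrationality.Zudilin2014
open Summit.KontsevichZagierPeriods.Zeta5Search.FormalBarnes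
open Summit.KontsevichZagierPeriods.Zeta5Search.Certificates.TwoTaleTelescope

namespace Summit.KontsevichZagierPeriods.Zeta5Search.TwoTaleOmega

namespace Pt

variable (p : Pt)

/-- `x_R` at the point `p`. -/
def xB : ℚ := ((p.g : ℚ) - p.b - 1) * ((p.g : ℚ) + p.b - p.a - 1)

/-- The rational certificate `Cert_R(p; u/2)` in the lattice variable. -/
def certBR (u : ℚ) : ℚ :=
  (u + p.a - 1) * (u + p.a) * (u / 2 + (p.a - p.b : ℤ)) * (u / 2 + (p.e + p.f - 1 : ℤ)) * (u / 2 + (p.g - 1 : ℤ)) * p.xB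
    / ((u + (p.a - p.b + p.g - 1 : ℤ)) * (u + (p.a - p.b + p.g - 2 : ℤ)) * (u + (p.a - p.b + p.g - 3 : ℤ)))

/-! ### The telescoped function `G = Cert_R · F_R(p;·)` as closed-form data -/

/-- Pole range `2·[e, e+f−1)` of `G`. -/
def AG : Finset ℤ := (Ico p.e (p.e + p.f - 1)).image (fun i => 2 * i)

/-- Pole range `2·[a, g−1)` of `G`. -/
def BG : Finset ℤ := (Ico p.a (p.g - 1)).image (fun i => 2 * i)

/-- Numerator of `G` on the even lattice. -/
def NGR : ℚ[X] :=
  C (p.xB * p.kap * 2 ^ (p.g - p.b - 2).toNat) * (block (p.a - 1) (p.g - p.b + p.a - 3) * eblock (p.a - p.b) p.f)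

/-- **The telescoped data** `G_{b,R}(p)`. -/
def GfBR : PF := PF.ofFrac (p.AG ∪ p.BG) (twoRange p.AG p.BG) p.NGR

variable {p}

/-- Membership in `AG`. -/
theorem mem_AG {K : ℤ} : K ∈ p.AG ↔ ∃ i, p.e ≤ i ∧ i < p.e + p.f - 1 ∧ K = 2 * i := by
  unfold AG; simp only [mem_image, mem_Ico]; constructor
  · rintro ⟨i, ⟨h1, h2⟩, rfl⟩; exact ⟨i, h1, h2, rfl⟩
  · rintro ⟨i, h1, h2, rfl⟩; exact ⟨i, ⟨h1, h2⟩, rfl⟩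

/-- Membership in `BG`. -/
theorem mem_BG {K : ℤ} : K ∈ p.BG ↔ ∃ i, p.a ≤ i ∧ i < p.g - 1 ∧ K = 2 * i := by
  unfold BG; simp only [mem_image, mem_Ico]; constructor
  · rintro ⟨i, ⟨h1, h2⟩, rfl⟩; exact ⟨i, h1, h2, rfl⟩
  · rintro ⟨i, h1, h2, rfl⟩; exact ⟨i, ⟨h1, h2⟩, rfl⟩

/-- Every point of `AG ∪ BG` and of `AR ∪ BR` lies in `[1, 4g]` on Ω (used to pass from a big exceptional set). -/
theorem mem_Icc_of_mem (h : p.Omega) {K : ℤ} (hK : K ∈ p.AG ∪ p.BG ∨ K ∈ p.AR ∪ p.BR) : 1 ≤ K ∧ K ≤ 4 * p.g := by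
  have := h.pos; have := h.e_le; have := h.f_le; have := h.a_lt_g
  rcases hK with hK | hK <;> rcases mem_union.1 hK with hK | hK
  · obtain ⟨i, h1, h2, rfl⟩ := mem_AG.1 hK; omega
  · obtain ⟨i, h1, h2, rfl⟩ := mem_BG.1 hK; omega
  · obtain ⟨i, h1, h2, rfl⟩ := mem_AR.1 hK; omega
  · obtain ⟨i, h1, h2, rfl⟩ := mem_BR.1 hK; omega

/-- The polynomial part of `G_{b,R}` is constant. -/
theorem natDegree_GfBR (h : p.Omega) (h3 : (p.addB 3).Omega) : p.GfBR.poly.natDegree = 0 := by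
  have q8 := h3.b3_le_g; simp only [addB_b, addB_g] at q8
  obtain ⟨o1, o2, o3, o4, o5, o6, o7, o8, o9⟩ := h
  have hx : p.xB ≠ 0 := by
    unfold xB
    have h1 : ((p.g : ℚ) - p.b - 1) = ((p.g - p.b - 1 : ℤ) : ℚ) := by push_cast; ring
    have h2 : ((p.g : ℚ) + p.b - p.a - 1) = ((p.g + p.b - p.a - 1 : ℤ) : ℚ) := by push_cast; ring
    rw [h1, h2]
    exact mul_ne_zero (by exact_mod_cast (by omega : (p.g - p.b - 1 : ℤ) ≠ 0))
      (by exact_mod_cast (by omega : (p.g + p.b - p.a - 1 : ℤ) ≠ 0))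
  have hc : p.xB * p.kap * 2 ^ (p.g - p.b - 2).toNat ≠ 0 :=
    mul_ne_zero (mul_ne_zero hx kap_ne_zero) (pow_ne_zero _ two_ne_zero)
  unfold GfBR
  rw [PF.natDegree_ofFrac, sum_twoRange]
  unfold NGR AG BG
  rw [natDegree_C_mul hc, natDegree_mul (block_ne_zero _ _) (eblock_ne_zero _ _), natDegree_block, natDegree_eblock,
    card_image_of_injective _ fun x y h => mul_left_cancel₀ two_ne_zero h,
    card_image_of_injective _ fun x y h => mul_left_cancel₀ two_ne_zero h, Int.card_Ico, Int.card_Ico]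
  omega

/-- **`G = Cert_R · F_R`**: off the exceptional lattice, `G_{b,R}(u) = Cert_R(u/2)·vR(p)(u)`. -/
theorem GfBR_eq_cert (h : p.Omega) (h3 : (p.addB 3).Omega) {u : ℚ}
    (hu : ∀ K ∈ Icc 1 (4 * p.g), u + K ≠ 0) : p.GfBR.eval u = p.certBR u * p.vR.eval u := by
  have q8 := h3.b3_le_g; simp only [addB_b, addB_g] at q8
  have hp := h.pos
  obtain ⟨o1, o2, o3, o4, o5, o6, o7, o8, o9⟩ := id h
  have huG : ∀ K ∈ p.AG ∪ p.BG, u + K ≠ 0 := fun K hK =>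
    hu K (mem_Icc.2 (mem_Icc_of_mem h (Or.inl hK)))
  have huR : ∀ K ∈ p.AR ∪ p.BR, u + K ≠ 0 := fun K hK =>
    hu K (mem_Icc.2 (mem_Icc_of_mem h (Or.inr hK)))
  rw [vR_eq_ofFrac h]
  unfold GfBR
  rw [PF.eval_ofFrac _ _ _ (fun _ hk => twoRange_mem hk) huG, PF.eval_ofFrac _ _ _ (fun _ hk => twoRange_mem hk) huR,
    denom_twoRange, denom_twoRange]
  unfold AG BG AR BR NGR NR certBR
  rw [← eblock_eq_prod_image, ← eblock_eq_prod_image, ← eblock_eq_prod_image, ← eblock_eq_prod_image]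
  -- block splits
  rw [← block_mul_block (lo := p.a + 1) (mi := p.g - p.b + p.a - 3) (hi := p.g - p.b + p.a) (by omega) (by omega),
    block_succ_left (lo := p.a - 1) (hi := p.g - p.b + p.a - 3) (by omega),
    block_succ_left (lo := p.a - 1 + 1) (hi := p.g - p.b + p.a - 3) (by omega),
    show p.a - 1 + 1 + 1 = p.a + 1 by ring, show p.a - 1 + 1 = p.a by ring,
    eblock_succ_left (lo := p.a - p.b) (hi := p.f) (by omega),
    show p.e + p.f = (p.e + p.f - 1) + 1 by ring, eblock_succ_right (lo := p.e) (hi := p.e + p.f - 1) (by omega),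
    show p.e + p.f - 1 + 1 - 1 = p.e + p.f - 1 by ring,
    show p.g = (p.g - 1) + 1 by ring, eblock_succ_right (lo := p.a) (hi := p.g - 1) (by omega)]
  simp only [show p.g - 1 + 1 = p.g by ring]
  have e3 := (eval_block_123 (p.g - p.b + p.a - 3) u).2.2
  rw [show p.g - p.b + p.a - 3 + 3 = p.g - p.b + p.a by ring] at e3
  simp only [Polynomial.eval_mul, Polynomial.eval_C, eval_lin, e3]
  -- non-vanishing of the cleared denominators
  have nz : ∀ K : ℤ, 1 ≤ K → K ≤ 4 * p.g → u + K ≠ 0 := fun K h1 h2 => hu K (mem_Icc.2 ⟨h1, h2⟩)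
  have hDe : (eblock p.e (p.e + p.f - 1)).eval u ≠ 0 := by
    rw [eval_eblock]; exact prod_ne_zero_iff.2 fun i hi heq => nz (2 * i) (by rw [mem_Ico] at hi; omega)
      (by rw [mem_Ico] at hi; omega) (by push_cast; exact heq)
  have hDa : (eblock p.a (p.g - 1)).eval u ≠ 0 := by
    rw [eval_eblock]; exact prod_ne_zero_iff.2 fun i hi heq => nz (2 * i) (by rw [mem_Ico] at hi; omega)
      (by rw [mem_Ico] at hi; omega) (by push_cast; exact heq)
  have n1 := nz (2 * (p.e + p.f - 1)) (by omega) (by omega)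
  have n2 := nz (2 * (p.g - 1)) (by omega) (by omega)
  have n3 := nz (p.a - p.b + p.g - 1) (by omega) (by omega)
  have n4 := nz (p.a - p.b + p.g - 2) (by omega) (by omega)
  have n5 := nz (p.a - p.b + p.g - 3) (by omega) (by omega)
  have hpow : (2 : ℚ) ^ (p.g - p.b + 1).toNat = 2 ^ (p.g - p.b - 2).toNat * 8 := by
    rw [show (p.g - p.b + 1).toNat = (p.g - p.b - 2).toNat + 3 by omega, pow_add]; norm_num
  push_cast at n1 n2 n3 n4 n5 ⊢
  rw [hpow]
  field_simp
  ring

/-! ### Step (2): the function identity -/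

/-- The exceptional set for Lemma U (second tale, direction `b`): a lattice interval containing every pole of the four
data and of the twice-shifted `G`, and every zero of the cleared denominators. -/
def SbR : Finset ℤ := Icc (-(4 * p.g)) (5 * p.g)

set_option maxHeartbeats 1600000 in
/-- **Function identity** `Σ_k c^b_k(p) F_R(p+kδ;u) = G(u+2) − G(u)` off the exceptional set. -/
theorem funId_bR (h0 : p.Omega) (h1 : (p.addB 1).Omega) (h2 : (p.addB 2).Omega) (h3 : (p.addB 3).Omega) {u : ℚ}
    (hu : ∀ K ∈ p.SbR, u + K ≠ 0) :
    p.coefB 0 * p.vR.eval u + p.coefB 1 * (p.addB 1).vR.eval u + p.coefB 2 * (p.addB 2).vR.eval u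
      + p.coefB 3 * (p.addB 3).vR.eval u = p.GfBR.eval (u + 2) - p.GfBR.eval u := by
  have q8 := h3.b3_le_g; simp only [addB_b, addB_g] at q8
  have hp := h0.pos
  obtain ⟨o1, o2, o3, o4, o5, o6, o7, o8, o9⟩ := id h0
  have nz : ∀ K : ℤ, -(4 * p.g) ≤ K → K ≤ 5 * p.g → u + K ≠ 0 := fun K hK1 hK2 => hu K (by unfold SbR; rw [mem_Icc]; omega)
  have hu1 : ∀ K ∈ Icc 1 (4 * p.g), u + K ≠ 0 := fun K hK => by rw [mem_Icc] at hK; exact nz K (by omega) (by omega)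
  have hu1' : ∀ K ∈ Icc 1 (4 * p.g), u + 2 + K ≠ 0 := fun K hK => by
    rw [mem_Icc] at hK; have := nz (K + 2) (by omega) (by omega); push_cast at this; rwa [add_assoc, add_comm (2:ℚ)]
  have huR : ∀ K ∈ p.AR ∪ p.BR, u + K ≠ 0 := fun K hK => hu1 K (mem_Icc.2 (mem_Icc_of_mem h0 (Or.inr hK)))
  have huR2 : ∀ K ∈ p.AR ∪ p.BR, u + 2 + K ≠ 0 := fun K hK => hu1' K (mem_Icc.2 (mem_Icc_of_mem h0 (Or.inr hK)))
  -- the four values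
  set F0 := p.vR.eval u with hF0
  set F0' := p.vR.eval (u + 2) with hF0'
  have r1 := vR_ratio_addB h0 1 h1 huR
  have r2 := vR_ratio_addB h0 2 h2 huR
  have r3 := vR_ratio_addB h0 3 h3 huR
  have eb1 := (eval_block_123 (p.g - p.b - 1 + p.a) u).1
  have eb2 := (eval_block_123 (p.g - p.b - 2 + p.a) u).2.1
  have eb3 := (eval_block_123 (p.g - p.b - 3 + p.a) u).2.2
  have nb1 := (eval_block_123 (p.a - p.b) (u / 2)).1
  have nb2 := (eval_block_123 (p.a - p.b - 1) (u / 2)).2.1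
  have nb3 := (eval_block_123 (p.a - p.b - 2) (u / 2)).2.2
  rw [show p.g - p.b - 1 + p.a + 1 = p.g - p.b + p.a by ring] at eb1
  rw [show p.g - p.b - 2 + p.a + 2 = p.g - p.b + p.a by ring] at eb2
  rw [show p.g - p.b - 3 + p.a + 3 = p.g - p.b + p.a by ring] at eb3
  rw [show p.a - p.b - 1 + 2 = p.a - p.b + 1 by ring] at nb2
  rw [show p.a - p.b - 2 + 3 = p.a - p.b + 1 by ring] at nb3
  push_cast at r1 r2 r3 eb1 eb2 eb3 nb1 nb2 nb3
  rw [show p.a - p.b - 1 + 1 = p.a - p.b by ring, eb1, nb1] at r1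
  rw [show p.a - p.b - 2 + 1 = p.a - p.b - 1 by ring, eb2, nb2] at r2
  rw [show p.a - p.b - 3 + 1 = p.a - p.b - 2 by ring, eb3, nb3] at r3
  simp only [prod_range_succ, prod_range_zero] at r1 r2 r3
  push_cast at r1 r2 r3
  -- the shift and the values of G
  have hS := vR_shift h0 huR huR2
  rw [← hF0, ← hF0'] at hS
  push_cast at hS
  have eG0 := GfBR_eq_cert h0 h3 hu1
  have eG2 := GfBR_eq_cert h0 h3 (u := u + 2) hu1'
  rw [← hF0] at eG0
  rw [← hF0'] at eG2
  -- cert-2's cleared identity at t = u/2, atoms kept opaque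
  have hc := telescope_b_R (p.a : ℚ) p.b p.e p.f p.g (u / 2)
  simp only [numBR0, denBR0, lprod_nil, mul_one, one_mul, xBR_eval] at hc
  have c0 : p.coefB 0 = spvalC Certificates.TwoTaleTelescope.cB0 (p.a : ℚ) p.b p.e p.f p.g := rfl
  have c1 : p.coefB 1 = spvalC Certificates.TwoTaleTelescope.cB1 (p.a : ℚ) p.b p.e p.f p.g := rfl
  have c2 : p.coefB 2 = spvalC Certificates.TwoTaleTelescope.cB2 (p.a : ℚ) p.b p.e p.f p.g := rfl
  have c3 : p.coefB 3 = spvalC Certificates.TwoTaleTelescope.cB3 (p.a : ℚ) p.b p.e p.f p.g := rfl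
  -- non-vanishing of the cleared denominators
  have hd1 := nz (p.a - p.b + p.g - 1) (by omega) (by omega)
  have hd2 := nz (p.a - p.b + p.g - 2) (by omega) (by omega)
  have hd3 := nz (p.a - p.b + p.g - 3) (by omega) (by omega)
  have hd4 := nz (p.a - p.b + p.g + 1) (by omega) (by omega)
  have hd5 := nz (p.a - p.b + p.g) (by omega) (by omega)
  have ht1 := nz (p.a + 1) (by omega) (by omega)
  have ht2 := nz (p.a + 2) (by omega) (by omega)
  have ht3 := nz (2 * (p.a - p.b + 1)) (by omega) (by omega)
  have ht4 := nz (2 * (p.e + p.f)) (by omega) (by omega)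
  have ht5 := nz (2 * p.g) (by omega) (by omega)
  push_cast at hd1 hd2 hd3 hd4 hd5 ht1 ht2 ht3 ht4 ht5
  have key := telescope_assembly (F0 := F0) (F0' := F0')
    (F1 := (p.addB 1).vR.eval u) (F2 := (p.addB 2).vR.eval u) (F3 := (p.addB 3).vR.eval u)
    (c0 := p.coefB 0) (c1 := p.coefB 1) (c2 := p.coefB 2) (c3 := p.coefB 3)
    (s1 := -1) (s2 := 1) (s3 := -1)
    (n1 := lprod numBR1 (p.a : ℚ) p.b p.e p.f p.g (u / 2)) (n2 := lprod numBR2 (p.a : ℚ) p.b p.e p.f p.g (u / 2))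
    (n3 := lprod numBR3 (p.a : ℚ) p.b p.e p.f p.g (u / 2))
    (d1 := lprod denBR1 (p.a : ℚ) p.b p.e p.f p.g (u / 2)) (d2 := lprod denBR2 (p.a : ℚ) p.b p.e p.f p.g (u / 2))
    (d3 := lprod denBR3 (p.a : ℚ) p.b p.e p.f p.g (u / 2))
    (tn := lprod tnBR (p.a : ℚ) p.b p.e p.f p.g (u / 2)) (td := lprod tdBR (p.a : ℚ) p.b p.e p.f p.g (u / 2))
    (cnum := lprod cnumBR (p.a : ℚ) p.b p.e p.f p.g (u / 2)) (cnumS := lprod cnumSBR (p.a : ℚ) p.b p.e p.f p.g (u / 2))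
    (cden := lprod cdenBR (p.a : ℚ) p.b p.e p.f p.g (u / 2)) (cdenS := lprod cdenSBR (p.a : ℚ) p.b p.e p.f p.g (u / 2))
    (x0 := ((p.g : ℚ) - p.b - 1) * ((p.g : ℚ) + p.b - p.a - 1)) (x1 := ((p.g : ℚ) - p.b - 1) * ((p.g : ℚ) + p.b - p.a - 1))
    (by rw [denBR1_eval, numBR1_eval]; linear_combination r1)
    (by rw [denBR2_eval, numBR2_eval]; linear_combination r2)
    (by rw [denBR3_eval, numBR3_eval]; linear_combination r3)
    (by rw [tdBR_eval, tnBR_eval]; linear_combination hS)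
    (by rw [denBR1_eval]; intro h; exact hd1 (by linarith))
    (by rw [denBR2_eval]; exact mul_ne_zero (fun h => hd1 (by linarith)) (fun h => hd2 (by linarith)))
    (by rw [denBR3_eval]
        exact mul_ne_zero (mul_ne_zero (fun h => hd1 (by linarith)) (fun h => hd2 (by linarith))) (fun h => hd3 (by linarith)))
    (by rw [tdBR_eval]
        exact mul_ne_zero (mul_ne_zero (mul_ne_zero (mul_ne_zero (fun h => ht1 (by linarith)) (fun h => ht2 (by linarith)))
          (fun h => ht3 (by linarith))) (fun h => ht4 (by linarith))) (fun h => ht5 (by linarith)))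
    (by rw [cdenBR_eval]
        exact mul_ne_zero (mul_ne_zero (fun h => hd1 (by linarith)) (fun h => hd2 (by linarith))) (fun h => hd3 (by linarith)))
    (by rw [cdenSBR_eval]
        exact mul_ne_zero (mul_ne_zero (fun h => hd4 (by linarith)) (fun h => hd5 (by linarith))) (fun h => hd1 (by linarith)))
    (by rw [c0, c1, c2, c3]; linear_combination hc)
  rw [eG2, eG0, key, cnumSBR_eval, cnumBR_eval, cdenSBR_eval, cdenBR_eval]
  unfold certBR xB
  push_cast
  ring

/-! ### Step (3): the DATA identity -/

/-- The poles of `vR q` lie in `[1, 4g]` for `q ∈ Ω`. -/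
theorem poles_vR_Icc {q : Pt} (hq : q.Omega) : q.vR.poles ⊆ Icc 1 (4 * q.g) := fun K hK => by
  rw [vR_eq_ofFrac hq] at hK
  exact mem_Icc.2 (mem_Icc_of_mem hq (Or.inr (PF.poles_ofFrac _ _ _ hK)))

/-- **Data identity** `Σ_k c^b_k(p)·vR(p+kδ) = S²G − G` (Lemma U over the exceptional set `SbR`). -/
theorem dataId_bR (h0 : p.Omega) (h1 : (p.addB 1).Omega) (h2 : (p.addB 2).Omega) (h3 : (p.addB 3).Omega) :
    PF.comb4 p.coefB ![p.vR, (p.addB 1).vR, (p.addB 2).vR, (p.addB 3).vR]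
      = p.GfBR.shift.shift.add (p.GfBR.smul (-1)) := by
  have hp := h0.pos
  have hIcc : ∀ q : Pt, q.Omega → q.g = p.g → q.vR.poles ⊆ p.SbR := fun q hq hqg K hK => by
    have := mem_Icc.1 (poles_vR_Icc hq hK); unfold SbR; rw [mem_Icc]; omega
  refine PF.eq_of_eval_eq_on _ _ p.SbR ?_ ?_ fun u hu => ?_
  · refine (PF.poles_comb4_subset _ _).trans (union_subset (union_subset ?_ ?_) (union_subset ?_ ?_)) <;>
      simp only [Matrix.cons_val_zero, Matrix.cons_val_one, Matrix.cons_val_two, Matrix.cons_val_three,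
        Matrix.head_cons, Matrix.tail_cons]
    · exact hIcc p h0 rfl
    · exact hIcc _ h1 rfl
    · exact hIcc _ h2 rfl
    · exact hIcc _ h3 rfl
  · have hG : p.GfBR.poles ⊆ Icc 1 (4 * p.g) := fun K hK =>
      mem_Icc.2 (mem_Icc_of_mem h0 (Or.inl (PF.poles_ofFrac _ _ _ hK)))
    refine (PF.poles_shift2_sub_subset _).trans (union_subset ?_ (hG.trans fun K hK => ?_))
    · intro K hK
      obtain ⟨j, hj, rfl⟩ := mem_image.1 hK
      obtain ⟨i, hi, rfl⟩ := mem_image.1 hj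
      have := mem_Icc.1 (hG hi); unfold SbR; rw [mem_Icc]; omega
    · have := mem_Icc.1 hK; unfold SbR; rw [mem_Icc]; omega
  · rw [PF.eval_comb4, PF.eval_shift2_sub, Fin.sum_univ_four]
    simp only [Matrix.cons_val_zero, Matrix.cons_val_one, Matrix.cons_val_two, Matrix.cons_val_three,
      Matrix.head_cons, Matrix.tail_cons]
    exact funId_bR h0 h1 h2 h3 hu

/-! ### Step (4): legitimacy at the common node `M* = −a` -/

/-- At `u = −a` and `u = −a+1` the telescoped function has simple zeros and no pole: all four formal residues vanish. -/
theorem GfBR_altRes (h : p.Omega) (h3 : (p.addB 3).Omega) :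
    altRes0 (-p.a) p.GfBR = 0 ∧ altRes0 (-p.a + 1) p.GfBR = 0 ∧ altRes1 (-p.a) p.GfBR = 0 ∧
      altRes1 (-p.a + 1) p.GfBR = 0 := by
  have q8 := h3.b3_le_g; simp only [addB_b, addB_g] at q8
  obtain ⟨o1, o2, o3, o4, o5, o6, o7, o8, o9⟩ := h
  have hm : ∀ k ∈ p.AG ∪ p.BG, twoRange p.AG p.BG k = 1 ∨ twoRange p.AG p.BG k = 2 := fun _ hk => twoRange_mem hk
  have hnot : ∀ K : ℤ, K ≤ p.a → K ∉ p.AG ∪ p.BG := fun K hK hmem => by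
    rcases mem_union.1 hmem with h | h
    · obtain ⟨i, h1, h2, h3⟩ := mem_AG.1 h; omega
    · obtain ⟨i, h1, h2, h3⟩ := mem_BG.1 h; omega
  have hdvd : ∀ K : ℤ, p.a - 1 ≤ K → K < p.g - p.b + p.a - 3 → lin K ∣ p.NGR := fun K h1 h2 => by
    unfold NGR; exact ((lin_dvd_block h1 h2).mul_right _).mul_left _
  unfold GfBR
  refine ⟨?_, ?_, ?_, ?_⟩
  · rw [altRes0_eq_eval]
    refine mul_eq_zero_of_right _ (PF.eval_ofFrac_eq_zero_of_dvd _ _ _ hm (by rw [neg_neg]; exact hnot p.a le_rfl) ?_)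
    rw [neg_neg]; exact hdvd p.a (by omega) (by omega)
  · rw [altRes0_eq_eval]
    refine mul_eq_zero_of_right _ ?_
    have e : -(-p.a + 1) = p.a - 1 := by ring
    exact PF.eval_ofFrac_eq_zero_of_dvd _ _ p.NGR hm (M := -p.a + 1) (by rw [e]; exact hnot _ (by omega))
      (by rw [e]; exact hdvd _ (by omega) (by omega))
  · exact altRes1_ofFrac_eq_zero _ _ _ (by rw [neg_neg]; exact hnot p.a le_rfl)
  · exact altRes1_ofFrac_eq_zero _ _ _ (by rw [show -(-p.a + 1) = p.a - 1 by ring]; exact hnot _ (by omega))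

/-! ### Step (5): node moves -/

/-- Along `δ_b`: the own second-tale node of `p+kδ` lies left of `−a`, and every point in between is in its window:
`E_{nodeR(p+kδ)}[vR(p+kδ)] = E_{−a}[vR(p+kδ)]` in both coordinates. -/
theorem altE_nodes_bR {k : ℤ} (hk : (p.addB k).Omega) (d : ℕ) :
    altE0 d (p.addB k).nodeR (p.addB k).vR = altE0 d (-p.a) (p.addB k).vR ∧
      altE1 (p.addB k).nodeR (p.addB k).vR = altE1 (-p.a) (p.addB k).vR := by
  have h0 := a0star_t2a_eq hk
  have q7 := hk.a_lt_g; have q8 := hk.b3_le_g; have q1 := hk.twoE; have q2 := hk.twoF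
  simp only [addB_a, addB_b, addB_e, addB_f, addB_g] at h0 q7 q8 q1 q2
  obtain ⟨n, hn⟩ : ∃ n : ℕ, -p.a = (p.addB k).nodeR + n :=
    ⟨(-p.a - (p.addB k).nodeR).toNat, by rw [Int.toNat_of_nonneg (by unfold nodeR; omega)]; ring⟩
  rw [hn]
  exact altE_vR_move hk _ n d (by unfold nodeR; omega) (by
    have : ((p.addB k).nodeR + (n : ℤ)) = -p.a := hn.symm
    simp only [addB_a]; omega)

/-! ### Step (6): the second-tale recurrence of direction `b` -/

/-- **Direction `b`, second tale.** For `p, p+δ, p+2δ, p+3δ ∈ Ω` (`δ = δ_b`), the second-tale functionals at their own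
nodes satisfy cert-2's telescoper (truncation `0`: every polynomial part involved is constant). -/
theorem recR_b (h0 : p.Omega) (h1 : (p.addB 1).Omega) (h2 : (p.addB 2).Omega) (h3 : (p.addB 3).Omega) :
    (p.coefB 0 * altE1 p.nodeR p.vR + p.coefB 1 * altE1 (p.addB 1).nodeR (p.addB 1).vR
      + p.coefB 2 * altE1 (p.addB 2).nodeR (p.addB 2).vR + p.coefB 3 * altE1 (p.addB 3).nodeR (p.addB 3).vR = 0) ∧
    (p.coefB 0 * altE0 0 p.nodeR p.vR + p.coefB 1 * altE0 0 (p.addB 1).nodeR (p.addB 1).vR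
      + p.coefB 2 * altE0 0 (p.addB 2).nodeR (p.addB 2).vR + p.coefB 3 * altE0 0 (p.addB 3).nodeR (p.addB 3).vR = 0) := by
  have hdata := dataId_bR h0 h1 h2 h3
  have hres := GfBR_altRes h0 h3
  have m0 := altE_nodes_bR (p := p) (k := 0) (by rw [addB_zero]; exact h0) 0
  rw [addB_zero] at m0
  have m1 := altE_nodes_bR (p := p) (k := 1) h1 0
  have m2 := altE_nodes_bR (p := p) (k := 2) h2 0
  have m3 := altE_nodes_bR (p := p) (k := 3) h3 0
  have s1 := altE1_step2 (-p.a) p.coefB _ p.GfBR hdata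
  have s0 := altE0_step2 0 (-p.a) p.coefB _ p.GfBR hdata (by rw [natDegree_GfBR h0 h3])
  rw [Fin.sum_univ_four] at s1 s0
  simp only [Matrix.cons_val_zero, Matrix.cons_val_one, Matrix.cons_val_two, Matrix.cons_val_three,
    Matrix.head_cons, Matrix.tail_cons] at s1 s0
  rw [hres.2.2.1, hres.2.2.2] at s1
  rw [hres.1, hres.2.1] at s0
  rw [m0.2, m1.2, m2.2, m3.2, m0.1, m1.1, m2.1, m3.1]
  constructor
  · linarith
  · linarith

end Pt

end Summit.KontsevichZagierPeriods.Zeta5Search.TwoTaleOmega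

end
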